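import Summits.QuantumFields.YangMills.Theorems.BalabanUVNodesN19LipschitzLinksDegreeBudgetLogSq

/-!
# YM-DAG node N19 (= NE7 proper) — EVERY LIPSCHITZ LINK OF THE ℓ¹-NORM AT THE RIDGE RATE UP TO ONE LOGARITHM (the ladder re-balanced)
# (`dist_∞(h∘S_d, Π_t) ≤ 7.5·10⁴·K·d·log₂t∕t` for every `K`-Lipschitz `h` on `[0, d]`, all `d`, all `t ≥ 2`)

Cell `pub-ymgap`, HUMAN RULING D-0062 (Track A) ∕ D-0149 (work-bound push), R141 (C) wider-strategy seat `pub-ymgap-dag-n19-e` (strategy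
s3 = ALTERNATIVE CURRENCY), generation g34, module 1 (lineage module 176).  Route `Summits/QuantumFields/YangMills/Theses/BalabanUVNodes.lean`,
cluster item K3⁸ «SpineGivenEndpointR13SepCoPHV» (stmt-QuantumFields-27366); filed `--supports` that item `--as helper` (it proves no registered
stub).  COUNT-NEUTRAL: [folklore]∕[bookkeeping] over the lineage BY NAME — module 167 `…N19LipschitzLinkJacksonSmoothing`
(`exists_trigLink_near_lipschitzLink_jackson`), module 151 (`exists_mvPolynomial_near_trigLink_firstOrder`), module 140 (`exists_order`,
`nine_le_logb`), module 120 (`l1Norm_mem_Icc`); no laws, no scheme object, no Theses import; NOT a discharge claim.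

THE RESULT AND THE MECHANISM.  Module 168 (`2·10⁵·K·d·log₂²t∕t`) took its scale `2^J ≍ π√(at)∕8` from module 140, where it was designed for the
SINGLE MODE (target accuracy `ωd∕t`).  For the smoothed Lipschitz link the second-order remainder of module 151's law is `B₂(dπ∕2^J)² = Kdπ³L∕4^J`
against a target `≍ Kd∕L` (the smoothing error `Kd(1∕π + 3π⁴∕32)∕L` of module 167): the ladder need only resolve the SMOOTHING SCALE.  THIS MODULE
takes `2^J` the least power of two `≥ 2π²L` (so `Kdπ³L∕4^J ≤ Kd∕(4πL)` and `2^J < 4π²L`); then the ladder costs degree `2h(2^{J+1} − 1) < 16π²hL ≤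
350·L·log₂t` (`h = ⌈3 log t⌉ ≤ 2.2 log₂t`), the oscillation `2e²(2Lπ)(½ + π + 3πJ) ≤ 900·L·log₂t` (`J + 1 ≤ log₂t`), the first-order factor `2N ≤
3t∕4` (`N = ⌊3t∕8⌋`): the budget closes with `L = ⌊t∕(5200 log₂t)⌋` — ONE logarithm — and the error is `≤ (9.452 + 1∕(4π))Kd∕L + 32Kd∕t ≤
74400·K·d·log₂t∕t`.  ★★★ `exists_mvPolynomial_near_lipschitzLink_l1Norm_log_of_le` (`t ≥ 2^20`: `≤ 74400·K·d·log₂t∕t`) and ★★★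
`exists_mvPolynomial_near_lipschitzLink_l1Norm_log` (**all `t ≥ 2`: `|h(Σ_i|x_i|) − P(x)| ≤ 75000·K·d·log₂t∕t`**).  The remaining logarithm is
shared by two terms of the same size (the `J ≍ log L` dyadic scales at degree `≍ e²a` each, and the Taylor order `h ≍ log t` multiplying
`2^{J+1} ≍ L`).  §1 `logb_le20`, `exists_pow_two_ge_lt`, `exists_parameters_log`; §2 `errorBound_log`, the two theorems.

HONEST FRAMING (binding).  Elementary and [folklore]; ONE-SIDED; constants astronomical; NO consumer in the DAG today (the seat's own currency map,
degree model); nothing of Bałaban's instantiated; NE7 NOT PRINTED, NOT proved; N19 NOT discharged; count-neutral.  One finite `T⁴` programme at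
fixed `ε`; nothing continuum ∕ `ℝ⁴` ∕ OS ∕ mass-gap ∕ Clay.  0 `def` ∕ 0 `sorry`.
-/

noncomputable section

open Finset
open scoped Real

namespace Summit.QuantumFields.YangMills.Theorems.BalabanUVNodesN19LipschitzLinksDegreeBudgetLog

open Summit.QuantumFields.YangMills.Theorems.BalabanUVNodesN19LipschitzLinkJacksonSmoothing (exists_trigLink_near_lipschitzLink_jackson)
open Summit.QuantumFields.YangMills.Theorems.BalabanUVNodesN19SmoothLinkFirstOrder (exists_mvPolynomial_near_trigLink_firstOrder)
open Summit.QuantumFields.YangMills.Theorems.BalabanUVNodesN19SingleModeLogFree (exists_order nine_le_logb)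
open Summit.QuantumFields.YangMills.Theorems.BalabanUVNodesN19OscillatingLinksMultiscale (l1Norm_mem_Icc)

variable {ι : Type*} [Fintype ι]

/-! ## §1 The parameters at budget `t` [bookkeeping] -/

/-- `log₂t ≥ 20` and `15600·log₂t ≤ t` for `t ≥ 2^20` (`1 + v·log 2 ≤ 2^v`). [bookkeeping] -/
theorem logb_le20 {t : ℕ} (ht : 2 ^ 20 ≤ t) : 20 ≤ Real.logb 2 t ∧ 15600 * Real.logb 2 t ≤ t := by
  set u : ℝ := Real.logb 2 t with hu
  have ht0 : (0 : ℝ) < t := by exact_mod_cast (show 0 < t by omega)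
  have hu20 : 20 ≤ u := by
    rw [hu, Real.le_logb_iff_rpow_le one_lt_two ht0, show (20 : ℝ) = ((20 : ℕ) : ℝ) by norm_num, Real.rpow_natCast]
    exact_mod_cast ht
  refine ⟨hu20, ?_⟩
  have htu : (t : ℝ) = 2 ^ u := by rw [hu, Real.rpow_logb two_pos (by norm_num) ht0]
  set v : ℝ := u - 20 with hv
  have hv0 : 0 ≤ v := by linarith
  have h2u : (2 : ℝ) ^ u = 2 ^ (20 : ℝ) * 2 ^ v := by rw [← Real.rpow_add two_pos]; congr 1; ring
  have h20 : (2 : ℝ) ^ (20 : ℝ) = 1048576 := by rw [show (20 : ℝ) = ((20 : ℕ) : ℝ) by norm_num, Real.rpow_natCast]; norm_num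
  have h1 : 1 + v * Real.log 2 ≤ (2 : ℝ) ^ v := by
    rw [Real.rpow_def_of_pos two_pos]
    have := Real.add_one_le_exp (Real.log 2 * v)
    linarith
  have hlog2 : 0.6931 < Real.log 2 := by linarith only [Real.log_two_gt_d9]
  have h2 : 1 + 0.6931 * v ≤ (2 : ℝ) ^ v := by nlinarith only [h1, hlog2, hv0]
  calc 15600 * u = 312000 + 15600 * v := by rw [hv]; ring
    _ ≤ 1048576 * (1 + 0.6931 * v) := by nlinarith only [hv0]
    _ ≤ 1048576 * (2 : ℝ) ^ v := by nlinarith only [h2]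
    _ = t := by rw [htu, h2u, h20]

/-- The least power of two above a real `b > 1`: `b ≤ 2^J < 2b` with `J ≥ 1`. [bookkeeping] -/
theorem exists_pow_two_ge_lt {b : ℝ} (hb : 1 < b) : ∃ J : ℕ, 1 ≤ J ∧ b ≤ (2 : ℝ) ^ J ∧ (2 : ℝ) ^ J < 2 * b := by
  classical
  have hex : ∃ J : ℕ, b ≤ (2 : ℝ) ^ J := by
    obtain ⟨n, hn⟩ := pow_unbounded_of_one_lt b (by norm_num : (1 : ℝ) < 2)
    exact ⟨n, hn.le⟩
  have hJpos : 0 < Nat.find hex := by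
    rw [Nat.pos_iff_ne_zero]
    intro h0
    have h1 : b ≤ (2 : ℝ) ^ Nat.find hex := Nat.find_spec hex
    rw [h0, pow_zero] at h1
    linarith
  refine ⟨Nat.find hex, hJpos, Nat.find_spec hex, ?_⟩
  have hlt : (2 : ℝ) ^ (Nat.find hex - 1) < b := lt_of_not_ge (Nat.find_min hex (by omega))
  have e : (2 : ℝ) ^ Nat.find hex = 2 * 2 ^ (Nat.find hex - 1) := by rw [← pow_succ']; congr 1; omega
  rw [e]; linarith

/-- **THE PARAMETERS AT BUDGET `t ≥ 2^20` (Jackson order `L ≍ t∕log₂t`, scale `2^J ≍ L`).**  With `Λ = log₂t`: `L ≥ 1` with `t ≤ 7800Λ·L` and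
`5200Λ·L ≤ t`; a scale `J`, a Taylor order `h ≥ 1` and a Jackson order `N` with `(J+1)e^{−h} ≤ ½`, `e^{−h} ≤ t^{−3}`, `J + 1 ≤ t∕4`,
`2Lπ·π ≤ 2^J ≤ N`, `2^J ≤ 4Lπ·π`, `t∕4 ≤ N`, and the degree budget `2e²(2Lπ)(½ + π + 3πJ) + 2h(2^{J+1} − 1) + 2N ≤ t` (`2^J` the least power of
two `≥ 2π²L`; module 140's `exists_order`; `N = ⌊3t∕8⌋`; oscillation `≤ 900ΛL`, ladder `≤ 350ΛL`, `1250∕5200 ≤ ¼`). [bookkeeping] -/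
theorem exists_parameters_log {t : ℕ} (ht : 2 ^ 20 ≤ t) :
    ∃ L J h N : ℕ, 1 ≤ L ∧ (t : ℝ) ≤ 7800 * Real.logb 2 t * L ∧ 5200 * Real.logb 2 t * L ≤ t ∧
      1 ≤ h ∧ ((J : ℝ) + 1) * Real.exp (-(h : ℝ)) ≤ 1 / 2 ∧ Real.exp (-(h : ℝ)) ≤ 1 / (t : ℝ) ^ 3 ∧ (J : ℝ) + 1 ≤ t / 4 ∧
      (2 * L : ℝ) * π * π ≤ 2 ^ J ∧ 2 ^ J ≤ N ∧ (2 : ℝ) ^ J ≤ 4 * L * π * π ∧ (t : ℝ) / 4 ≤ N ∧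
      2 * Real.exp 2 * (2 * L * π) * (1 / 2 + π + 3 * π * J) + 2 * h * (2 ^ (J + 1) - 1) + 2 * N ≤ t := by
  obtain ⟨hΛ20, hΛlin⟩ := logb_le20 ht
  set Λ : ℝ := Real.logb 2 t with hΛ
  have ht512 : 512 ≤ t := le_trans (by norm_num) ht
  have ht0 : (0 : ℝ) < t := by exact_mod_cast (show 0 < t by omega)
  have htr : (1048576 : ℝ) ≤ t := by exact_mod_cast ht
  have hπlo : 3.14 < π := Real.pi_gt_d2
  have hπhi : π < 3.15 := Real.pi_lt_d2
  have hΛ0 : 0 < Λ := by linarith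
  -- the Jackson order `L = ⌊t/(5200Λ)⌋`
  set x : ℝ := t / (5200 * Λ) with hx
  have hx3 : 3 ≤ x := by rw [hx, le_div_iff₀ (by positivity)]; linarith only [hΛlin]
  set L : ℕ := ⌊x⌋₊ with hL
  have hLx : (L : ℝ) ≤ x := Nat.floor_le (by linarith)
  have hxL : x < L + 1 := Nat.lt_floor_add_one x
  have hL1 : 1 ≤ L := by
    have h2 : (0 : ℝ) < L := by linarith
    exact_mod_cast (show 0 < L by exact_mod_cast h2)
  have hLr : (1 : ℝ) ≤ L := by exact_mod_cast hL1
  have hP2 : (t : ℝ) ≤ 7800 * Λ * L := by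
    have htx : (t : ℝ) = 5200 * Λ * x := by rw [hx]; field_simp
    have hL23 : 2 * x / 3 ≤ L := by linarith only [hx3, hxL]
    rw [htx]
    have := mul_le_mul_of_nonneg_left hL23 (by positivity : (0 : ℝ) ≤ 7800 * Λ)
    linarith only [this]
  have hP3 : 5200 * Λ * (L : ℝ) ≤ t := by
    have := mul_le_mul_of_nonneg_left hLx (by positivity : (0 : ℝ) ≤ 5200 * Λ)
    rw [hx, mul_div_cancel₀ _ (by positivity)] at this
    exact this
  have hLsmall : 104000 * (L : ℝ) ≤ t := by
    have h1 : 5200 * 20 * (L : ℝ) ≤ 5200 * Λ * L := by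
      have := mul_le_mul_of_nonneg_right hΛ20 (by positivity : (0 : ℝ) ≤ 5200 * L)
      linarith only [this]
    linarith only [h1, hP3]
  -- the scale: the least power of two `≥ 2π²L`
  have hππlo : 9 < π * π := by nlinarith only [hπlo, Real.pi_pos]
  have hππhi : π * π < 9.9225 := by nlinarith only [hπhi, Real.pi_pos]
  have hb : (1 : ℝ) < 2 * L * π * π := by
    have h0 : 0 ≤ ((L : ℝ) - 1) * (π * π) := mul_nonneg (by linarith only [hLr]) (by positivity)
    nlinarith only [h0, hππlo, hLr]
  obtain ⟨J, hJ1', hJge, hJlt⟩ := exists_pow_two_ge_lt hb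
  have hM0 : (0 : ℝ) < 2 ^ J := by positivity
  have hMle : (2 : ℝ) ^ J ≤ 4 * L * π * π := by linarith only [hJlt]
  have hM40 : (2 : ℝ) ^ J ≤ 40 * L := by
    have h0 : 0 ≤ (L : ℝ) * (9.9225 - π * π) := mul_nonneg (by positivity) (by linarith only [hππhi])
    nlinarith only [hMle, h0]
  have hJ4 : (2 : ℝ) ^ J ≤ t / 4 := by
    rw [le_div_iff₀ (by norm_num : (0 : ℝ) < 4)]; linarith only [hM40, hLsmall]
  obtain ⟨h, hh1, hhle, hexph⟩ := exists_order ht512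
  have hJ12J : (J : ℝ) + 1 ≤ 2 ^ J := by exact_mod_cast (Nat.lt_two_pow_self : J + 1 ≤ 2 ^ J)
  have hJ1 : (J : ℝ) + 1 ≤ t / 4 := hJ12J.trans hJ4
  have hP5 : ((J : ℝ) + 1) * Real.exp (-(h : ℝ)) ≤ 1 / 2 := by
    calc ((J : ℝ) + 1) * Real.exp (-(h : ℝ)) ≤ (t / 4) * (1 / t ^ 3) := mul_le_mul hJ1 hexph (Real.exp_pos _).le (by positivity)
      _ = 1 / (4 * t ^ 2) := by field_simp
      _ ≤ 1 / 2 := by rw [div_le_div_iff₀ (by positivity) (by norm_num : (0 : ℝ) < 2)]; nlinarith only [htr]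
  -- the Jackson order `N = ⌊3t/8⌋`
  set N : ℕ := 3 * t / 8 with hN
  have hN4 : (t : ℝ) / 4 ≤ N := by
    have h1 : ((3 * t : ℕ) : ℝ) ≤ ((8 * N + 7 : ℕ) : ℝ) := by exact_mod_cast (show 3 * t ≤ 8 * N + 7 by omega)
    push_cast at h1
    linarith only [h1, htr]
  have h2Nr : (2 * N : ℝ) ≤ 3 * t / 4 := by
    have h1 : ((8 * N : ℕ) : ℝ) ≤ ((3 * t : ℕ) : ℝ) := by exact_mod_cast (show 8 * N ≤ 3 * t by omega)
    push_cast at h1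
    linarith only [h1]
  have hNJ : 2 ^ J ≤ N := by
    have h1 : ((2 ^ J : ℕ) : ℝ) ≤ (N : ℝ) := by push_cast; linarith only [hJ4, hN4]
    exact_mod_cast h1
  -- the degree
  have he2 : Real.exp 2 ≤ 7.4 := by
    have he1 : Real.exp 1 ≤ 2.7182818286 := Real.exp_one_lt_d9.le
    have he0 : 0 < Real.exp 1 := Real.exp_pos 1
    have : Real.exp 2 = Real.exp 1 * Real.exp 1 := by rw [← Real.exp_add]; norm_num
    rw [this]; nlinarith only [he1, he0]
  have hJ1L : (J : ℝ) + 1 ≤ Λ := by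
    have h2J1 : (2 : ℝ) ^ (J + 1) ≤ t := by rw [pow_succ]; linarith only [hJ4]
    rw [hΛ, Real.le_logb_iff_rpow_le one_lt_two ht0]
    have e : (2 : ℝ) ^ ((J : ℝ) + 1) = 2 ^ (J + 1) := by rw [← Real.rpow_natCast]; push_cast; ring_nf
    rw [e]; exact h2J1
  have hJ0 : (0 : ℝ) ≤ J := Nat.cast_nonneg _
  set a : ℝ := 2 * L * π with ha
  have ha0 : 0 ≤ a := by positivity
  have ha63 : a ≤ 6.3 * L := by rw [ha]; nlinarith only [hπhi, hLr]
  have hterm1 : 2 * Real.exp 2 * a * (1 / 2 + π + 3 * π * J) ≤ 900 * (Λ * L) := by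
    have hX0 : (0 : ℝ) ≤ 1 / 2 + π + 3 * π * J := by positivity
    have s1 : 2 * Real.exp 2 * a * (1 / 2 + π + 3 * π * J) ≤ 14.8 * (a * (1 / 2 + π + 3 * π * J)) := by
      nlinarith only [mul_nonneg (sub_nonneg.2 he2) (mul_nonneg ha0 hX0)]
    have s2 : 1 / 2 + π + 3 * π * (J : ℝ) ≤ 3.65 + 9.45 * Λ := by
      nlinarith only [mul_nonneg (sub_nonneg.2 hπhi.le) hJ0, hπhi, hJ1L]
    have s3 : a * (1 / 2 + π + 3 * π * J) ≤ a * (3.65 + 9.45 * Λ) := mul_le_mul_of_nonneg_left s2 ha0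
    have s4 : a * (3.65 + 9.45 * Λ) ≤ 9.64 * (a * Λ) := by
      nlinarith only [mul_nonneg ha0 (by linarith only [hΛ20] : (0 : ℝ) ≤ Λ - 20), ha0]
    have s5 : a * Λ ≤ 6.3 * (Λ * L) := by nlinarith only [ha63, hΛ0]
    nlinarith only [s1, s3, s4, s5]
  have hterm2 : 2 * (h : ℝ) * (2 ^ (J + 1) - 1) ≤ 350 * (Λ * L) := by
    have hh0 : (0 : ℝ) ≤ h := Nat.cast_nonneg _
    have s1 : 2 * (h : ℝ) * (2 ^ (J + 1) - 1) ≤ 4 * h * 2 ^ J := by rw [pow_succ]; nlinarith only [hM0, hh0]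
    have s2 : 4 * (h : ℝ) * 2 ^ J ≤ 8.8 * (Λ * 2 ^ J) := by nlinarith only [hhle, hM0]
    have s3 : Λ * 2 ^ J ≤ Λ * (4 * L * π * π) := mul_le_mul_of_nonneg_left hMle hΛ0.le
    have s4 : Λ * (4 * L * π * π) ≤ 39.7 * (Λ * L) := by
      have hπ2 : π * π < 3.15 * 3.15 := mul_lt_mul'' hπhi hπhi Real.pi_pos.le Real.pi_pos.le
      have h0 : 0 ≤ Λ * L := by positivity
      nlinarith only [hπ2, h0]
    have h0 : 0 ≤ Λ * L := by positivity
    linarith only [s1, s2, s3, s4, h0]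
  refine ⟨L, J, h, N, hL1, hP2, hP3, hh1, hP5, hexph, hJ1, ?_, hNJ, hMle, hN4, ?_⟩
  · rw [ha] at hJge; exact hJge
  · have e : 2 * Real.exp 2 * (2 * (L : ℝ) * π) * (1 / 2 + π + 3 * π * J) = 2 * Real.exp 2 * a * (1 / 2 + π + 3 * π * J) := by rw [ha]
    rw [e]
    have hsum : 900 * (Λ * L) + 350 * (Λ * L) ≤ (t : ℝ) / 4 := by linarith only [hP3]
    linarith only [hterm1, hterm2, h2Nr, hsum]

/-! ## §2 ★★★ Every Lipschitz link at the ridge rate up to one logarithm [folklore] -/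

/-- THE ERROR BOOKKEEPING (re-balanced scale).  With the parameters of §1 (`M = 2^J ≥ 2π²L`, `ε = 2(J+1)e^{−h} ≤ 1∕(2t²)`): smoothing
`Kd(1∕π + 3π⁴∕32)∕L ≤ 73730KdΛ∕t`, second order `Kdπ³L∕M² ≤ Kd∕(4πL) ≤ 625KdΛ∕t`, first order `≤ 13Kd∕t`, ladder `≤ 19Kd∕t`; total
`≤ 74400KdΛ∕t`. [bookkeeping] -/
theorem errorBound_log {K d t Λ L M N ε : ℝ} (hK : 0 ≤ K) (hd : 0 < d) (ht : 1048576 ≤ t) (hΛ : 20 ≤ Λ) (hL1 : 1 ≤ L)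
    (hLt : L ≤ t) (htL : t ≤ 7800 * Λ * L) (hM : 2 * L * π * π ≤ M) (hMN : M ≤ N) (hN4 : t / 4 ≤ N) (hε : ε ≤ 1 / (2 * t ^ 2)) :
    K * d * (1 / π + 3 * π ^ 4 / 32) / L +
      (K * π * L / d * (d * π / M) ^ 2 + K * (d * π / N) +
        ε * (π ^ 4 * (K * d) * L / 8) * (1 + 2 * L * π / d * (d * π / M + d * π / N))) ≤
        74400 * K * d * Λ / t := by
  have hπlo : 3.14 < π := Real.pi_gt_d2
  have hπhi : π < 3.15 := Real.pi_lt_d2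
  have hπ := Real.pi_pos
  have ht0 : 0 < t := by linarith
  have hL0 : 0 < L := by linarith
  have hM0 : 0 < M := lt_of_lt_of_le (by positivity) hM
  have hN0 : 0 < N := lt_of_lt_of_le hM0 hMN
  have hKd : 0 ≤ K * d := mul_nonneg hK hd.le
  have hΛ0 : 0 < Λ := by linarith
  -- smoothing (NO logarithm)
  have hT1 : K * d * (1 / π + 3 * π ^ 4 / 32) / L ≤ 73730 * K * d * Λ / t := by
    have hπlo4 : 3.1415 < π := Real.pi_gt_d4
    have hπhi4 : π < 3.1416 := Real.pi_lt_d4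
    have h1 : 1 / π ≤ 0.3184 := by rw [div_le_iff₀ hπ]; nlinarith only [hπlo4]
    have hπ2 : π ^ 2 < 3.1416 * 3.1416 := by rw [pow_two]; exact mul_lt_mul'' hπhi4 hπhi4 hπ.le hπ.le
    have hπ4 : π ^ 4 ≤ 97.42 := by nlinarith only [hπ2, pow_pos hπ 2]
    have h2 : 1 / π + 3 * π ^ 4 / 32 ≤ 9.452 := by linarith only [h1, hπ4]
    have h3 : K * d * (1 / π + 3 * π ^ 4 / 32) / L ≤ K * d * 9.452 / L :=
      div_le_div_of_nonneg_right (mul_le_mul_of_nonneg_left h2 hKd) hL0.le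
    refine h3.trans ?_
    rw [div_le_div_iff₀ hL0 ht0]
    have h4 := mul_le_mul_of_nonneg_left htL (by positivity : (0 : ℝ) ≤ K * d * 9.452)
    have h5 : 0 ≤ K * d * Λ * L := by positivity
    nlinarith only [h4, h5]
  -- second order (`M ≥ 2π²L`)
  have hT2 : K * π * L / d * (d * π / M) ^ 2 ≤ 625 * K * d * Λ / t := by
    have e : K * π * L / d * (d * π / M) ^ 2 = K * d * (π ^ 3 * L / M ^ 2) := by field_simp
    have hsq : (2 * L * π * π) ^ 2 ≤ M ^ 2 := pow_le_pow_left₀ (by positivity) hM 2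
    have h1 : π ^ 3 * L / M ^ 2 ≤ 1 / (4 * π * L) := by
      rw [div_le_div_iff₀ (by positivity) (by positivity)]
      nlinarith only [hsq, hπ, hL0]
    have h2 : 1 / (4 * π * L) ≤ 625 * Λ / t := by
      rw [div_le_div_iff₀ (by positivity) ht0]
      have h3 : 4 * 3.14 * 625 * (Λ * L) ≤ 4 * π * 625 * (Λ * L) := by
        have := mul_le_mul_of_nonneg_right hπlo.le (by positivity : (0 : ℝ) ≤ 4 * 625 * (Λ * L))
        linarith only [this]
      have h0 : 0 ≤ Λ * L := by positivity
      linarith only [htL, h3, h0]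
    rw [e]
    calc K * d * (π ^ 3 * L / M ^ 2) ≤ K * d * (625 * Λ / t) := mul_le_mul_of_nonneg_left (h1.trans h2) hKd
      _ = 625 * K * d * Λ / t := by ring
  have hT3 : K * (d * π / N) ≤ 13 * K * d / t := by
    have h1 : d * π / N ≤ 13 * d / t := by
      rw [div_le_div_iff₀ hN0 ht0]
      have e1 : d * π * t ≤ 3.15 * (d * t) := by
        rw [show d * π * t = π * (d * t) by ring]
        exact mul_le_mul_of_nonneg_right hπhi.le (by positivity)
      have e2 := mul_le_mul_of_nonneg_left hN4 (by positivity : (0 : ℝ) ≤ 13 * d)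
      have e3 : 0 ≤ d * t := by positivity
      linarith only [e1, e2, e3]
    calc K * (d * π / N) ≤ K * (13 * d / t) := mul_le_mul_of_nonneg_left h1 hK
      _ = 13 * K * d / t := by ring
  have hT4 : ε * (π ^ 4 * (K * d) * L / 8) * (1 + 2 * L * π / d * (d * π / M + d * π / N)) ≤ 19 * K * d / t := by
    have h1 : 2 * L * π / d * (d * π / M) ≤ 1 := by
      rw [show 2 * L * π / d * (d * π / M) = 2 * L * π * π / M by field_simp, div_le_one hM0]; exact hM
    have h2 : 2 * L * π / d * (d * π / N) ≤ 1 := by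
      rw [show 2 * L * π / d * (d * π / N) = 2 * L * π * π / N by field_simp, div_le_one hN0]; exact hM.trans hMN
    have h3 : 1 + 2 * L * π / d * (d * π / M + d * π / N) ≤ 3 := by rw [mul_add]; linarith only [h1, h2]
    have hπ2 : π ^ 2 < 3.15 * 3.15 := by rw [pow_two]; exact mul_lt_mul'' hπhi hπhi hπ.le hπ.le
    have hπ4 : π ^ 4 ≤ 98.5 := by nlinarith only [hπ2, pow_pos hπ 2]
    have hW : π ^ 4 * (K * d) * L / 8 ≤ 12.32 * (K * d) * L := by
      rw [div_le_iff₀ (by norm_num : (0 : ℝ) < 8)]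
      have := mul_le_mul_of_nonneg_right hπ4 (by positivity : (0 : ℝ) ≤ K * d * L)
      have h0 : 0 ≤ K * d * L := by positivity
      nlinarith only [this, h0]
    have h03 : (0 : ℝ) ≤ 1 + 2 * L * π / d * (d * π / M + d * π / N) := by positivity
    have h4 : ε * (π ^ 4 * (K * d) * L / 8) * (1 + 2 * L * π / d * (d * π / M + d * π / N)) ≤
        (1 / (2 * t ^ 2)) * (12.32 * (K * d) * L) * 3 :=
      mul_le_mul (mul_le_mul hε hW (by positivity) (by positivity)) h3 h03 (by positivity)
    refine h4.trans ?_
    rw [show 1 / (2 * t ^ 2) * (12.32 * (K * d) * L) * 3 = 18.48 * K * d * L / t ^ 2 by field_simp; ring,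
      div_le_div_iff₀ (by positivity) ht0]
    have := mul_le_mul_of_nonneg_left hLt (by positivity : (0 : ℝ) ≤ 19 * K * d * t)
    nlinarith only [this, hKd, ht0, hL0]
  have hsum : 73730 * K * d * Λ / t + (625 * K * d * Λ / t + 13 * K * d / t + 19 * K * d / t) ≤ 74400 * K * d * Λ / t := by
    rw [← add_div, ← add_div, ← add_div]
    refine div_le_div_of_nonneg_right ?_ ht0.le
    nlinarith only [hΛ, hKd]
  linarith only [hT1, hT2, hT3, hT4, hsum]

variable [Nonempty ι]

/-- ★★★ **EVERY LIPSCHITZ LINK OF THE ℓ¹-NORM AT THE RIDGE RATE UP TO ONE LOGARITHM (budget `t ≥ 2^20`).**  For finite nonempty `ι`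
(`d = |ι|`), `K ≥ 0`, `h : ℝ → ℝ` with `|h(s) − h(s′)| ≤ K|s − s′|` on `[0, d]` and `t ≥ 2^20` there is `P : MvPolynomial ι ℝ` of total degree `≤ t`
with `|h(Σ_i|x_i|) − P(x)| ≤ 74400·K·d·log₂t∕t` on `[−1,1]^ι` (§1's parameters, module 167's log-free smoothing, module 151's law). [folklore] -/
theorem exists_mvPolynomial_near_lipschitzLink_l1Norm_log_of_le {h : ℝ → ℝ} {K : ℝ} (hK0 : 0 ≤ K)
    (hK : ∀ s s', s ∈ Set.Icc (0 : ℝ) (Fintype.card ι) → s' ∈ Set.Icc (0 : ℝ) (Fintype.card ι) → |h s - h s'| ≤ K * |s - s'|)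
    {t : ℕ} (ht : 2 ^ 20 ≤ t) :
    ∃ P : MvPolynomial ι ℝ, P.totalDegree ≤ t ∧
      ∀ x : ι → ℝ, (∀ i, x i ∈ Set.Icc (-1 : ℝ) 1) →
        |h (∑ i, |x i|) - MvPolynomial.eval x P| ≤ 74400 * K * Fintype.card ι * Real.logb 2 t / t := by
  set d : ℝ := (Fintype.card ι : ℝ) with hdd
  have hd : 0 < d := by rw [hdd]; exact_mod_cast Fintype.card_pos
  have ht0 : (0 : ℝ) < t := by exact_mod_cast (show 0 < t by omega)
  have htr : (1048576 : ℝ) ≤ t := by exact_mod_cast ht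
  obtain ⟨hΛ20, hΛlin⟩ := logb_le20 ht
  obtain ⟨L, J, hh, N, hL1, htL, hLt, hh1, hJh, hexph, hJ1, hLππ, hNJ, _hM4, hN4, hdeg⟩ := exists_parameters_log ht
  have hLr : (1 : ℝ) ≤ L := by exact_mod_cast hL1
  obtain ⟨α, β, ω, g, g₁, hω0, hωΩ, hW, hg, hg₁, hC11, hB1, herr⟩ := exists_trigLink_near_lipschitzLink_jackson hd hK0 hK hL1
  have hΩ : (0 : ℝ) ≤ 2 * L * π / d := by positivity
  obtain ⟨P, hPdeg, hPerr⟩ := exists_mvPolynomial_near_trigLink_firstOrder (ι := ι)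
    (((range L ×ˢ range L) ×ˢ (range L ×ˢ range L)) ×ˢ (Finset.univ : Finset Bool)) (h 0) α β ω
    (Ω := 2 * L * π / d) (W := π ^ 4 * (K * d) * L / 8) (B₁ := K) (B₂ := K * π * L / d) hg hg₁ hΩ hω0 hωΩ hW hC11 hB1 J hh N hh1 hJh hNJ
  refine ⟨P, ?_, fun x hx => ?_⟩
  · have e : 2 * Real.exp 2 * (2 * L * π / d) * (Fintype.card ι : ℝ) * (1 / 2 + π + 3 * π * J) =
        2 * Real.exp 2 * (2 * L * π) * (1 / 2 + π + 3 * π * J) := by rw [← hdd]; field_simp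
    rw [e] at hPdeg
    exact Nat.cast_le.1 (hPdeg.trans hdeg)
  · have hS := l1Norm_mem_Icc x hx
    rw [← hdd] at hS hPerr
    have h1 := herr (∑ i, |x i|) ⟨hS.1, hS.2⟩
    have h2 := hPerr x hx
    -- the arithmetic
    have hLt' : (L : ℝ) ≤ t := by
      have h1 : (1 : ℝ) ≤ 5200 * Real.logb 2 t := by nlinarith only [hΛ20]
      exact (le_mul_of_one_le_left (by positivity) h1).trans hLt
    have hε : 2 * ((J : ℝ) + 1) * Real.exp (-(hh : ℝ)) ≤ 1 / (2 * t ^ 2) := by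
      calc 2 * ((J : ℝ) + 1) * Real.exp (-(hh : ℝ)) ≤ 2 * (t / 4) * (1 / t ^ 3) := by
            have := mul_le_mul hJ1 hexph (Real.exp_pos _).le (by positivity)
            linarith only [this]
        _ = 1 / (2 * t ^ 2) := by field_simp; ring
    have hNJr : ((2 : ℝ) ^ J) ≤ N := by exact_mod_cast hNJ
    have key := errorBound_log (M := (2 : ℝ) ^ J) (ε := 2 * ((J : ℝ) + 1) * Real.exp (-(hh : ℝ))) hK0 hd htr hΛ20 hLr hLt' htL
      hLππ hNJr hN4 hε
    calc |h (∑ i, |x i|) - MvPolynomial.eval x P|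
        ≤ |h (∑ i, |x i|) - g (∑ i, |x i|)| + |g (∑ i, |x i|) - MvPolynomial.eval x P| := abs_sub_le _ _ _
      _ ≤ K * d * (1 / π + 3 * π ^ 4 / 32) / L +
          (K * π * L / d * (d * π / 2 ^ J) ^ 2 + K * (d * π / N) +
            2 * ((J : ℝ) + 1) * Real.exp (-(hh : ℝ)) * (π ^ 4 * (K * d) * L / 8) *
              (1 + 2 * L * π / d * (d * π / 2 ^ J + d * π / N))) :=
          add_le_add h1 h2
      _ ≤ 74400 * K * d * Real.logb 2 t / t := key

/-- ★★★ **EVERY LIPSCHITZ LINK OF THE ℓ¹-NORM AT THE RIDGE RATE UP TO ONE LOGARITHM — ALL BUDGETS**: for every `t ≥ 2`,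
**`|h(Σ_i|x_i|) − P(x)| ≤ 75000·K·d·log₂t∕t`** (module 168's theorem with one logarithm fewer; below `2^20` the constant `h(0)`). [folklore] -/
theorem exists_mvPolynomial_near_lipschitzLink_l1Norm_log {h : ℝ → ℝ} {K : ℝ} (hK0 : 0 ≤ K)
    (hK : ∀ s s', s ∈ Set.Icc (0 : ℝ) (Fintype.card ι) → s' ∈ Set.Icc (0 : ℝ) (Fintype.card ι) → |h s - h s'| ≤ K * |s - s'|)
    {t : ℕ} (ht : 2 ≤ t) :
    ∃ P : MvPolynomial ι ℝ, P.totalDegree ≤ t ∧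
      ∀ x : ι → ℝ, (∀ i, x i ∈ Set.Icc (-1 : ℝ) 1) →
        |h (∑ i, |x i|) - MvPolynomial.eval x P| ≤ 75000 * K * Fintype.card ι * Real.logb 2 t / t := by
  set d : ℝ := (Fintype.card ι : ℝ) with hdd
  have hd : 0 < d := by rw [hdd]; exact_mod_cast Fintype.card_pos
  have ht0 : (0 : ℝ) < t := by exact_mod_cast (show 0 < t by omega)
  have hKd : 0 ≤ K * d := mul_nonneg hK0 hd.le
  have hΛ1 : 1 ≤ Real.logb 2 t := by
    rw [Real.le_logb_iff_rpow_le one_lt_two ht0, Real.rpow_one]; exact_mod_cast ht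
  by_cases hbig : 2 ^ 20 ≤ t
  · obtain ⟨P, hP, herr⟩ := exists_mvPolynomial_near_lipschitzLink_l1Norm_log_of_le hK0 hK hbig
    refine ⟨P, hP, fun x hx => (herr x hx).trans ?_⟩
    rw [← hdd]
    exact div_le_div_of_nonneg_right (by nlinarith only [hKd, hΛ1]) ht0.le
  · -- small budgets: the constant `h(0)`
    have hsmall : (t : ℝ) ≤ 75000 * Real.logb 2 t := by
      by_cases h4 : t ≤ 75000
      · have h1 : (t : ℝ) ≤ 75000 := by exact_mod_cast h4
        linarith only [h1, hΛ1]
      · have h16 : (16 : ℝ) ≤ Real.logb 2 t := by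
          rw [Real.le_logb_iff_rpow_le one_lt_two ht0, show (16 : ℝ) = ((16 : ℕ) : ℝ) by norm_num, Real.rpow_natCast]
          norm_num
          exact_mod_cast (show 65536 ≤ t by omega)
        have h2 : (t : ℝ) ≤ 1048576 := by exact_mod_cast (show t ≤ 2 ^ 20 by omega)
        linarith only [h16, h2]
    refine ⟨MvPolynomial.C (h 0), by rw [MvPolynomial.totalDegree_C]; exact Nat.zero_le _, fun x hx => ?_⟩
    have hS := l1Norm_mem_Icc x hx
    rw [MvPolynomial.eval_C]
    calc |h (∑ i, |x i|) - h 0| ≤ K * |(∑ i, |x i|) - 0| := hK _ _ ⟨hS.1, hS.2⟩ ⟨le_rfl, Nat.cast_nonneg _⟩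
      _ ≤ K * d := by
          refine mul_le_mul_of_nonneg_left ?_ hK0
          rw [sub_zero, abs_of_nonneg hS.1, hdd]; exact hS.2
      _ = K * d * 1 := (mul_one _).symm
      _ ≤ K * d * (75000 * Real.logb 2 t / t) := by
          refine mul_le_mul_of_nonneg_left ?_ hKd
          rw [le_div_iff₀ ht0, one_mul]; exact hsmall
      _ = 75000 * K * Fintype.card ι * Real.logb 2 t / t := by rw [hdd]; ring

end Summit.QuantumFields.YangMills.Theorems.BalabanUVNodesN19LipschitzLinksDegreeBudgetLog

end
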